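import Literature.Computability.Cryptography.LWEPrimePowerParams
import Literature.Computability.Cryptography.LWEPrimePowerSchedule
import HarnessLib

/-!
# The Micciancio–Peikert reduction on BLPRS's schedule fails with probability at most `7/24`, for all large `n` (MP12 Thm. 3.1 / BLPRS Thm. 2.17)

Topic `Computability/Cryptography` (LWE), grouping namespace `LWE.MP12`, joining
`LWEPrimePowerParams.lean` (`idealLaw_gaussian_ne_le`: the failure bound of the idealised reduction with
Gaussian noises in abstract parameters) and `LWEPrimePowerSchedule.lean` (the schedule
`lev, aggK, gap, trials, reps, meas, extra, epsC` in BLPRS's setting and its asymptotics). Proved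
material (no named fact) towards
`Literature.Computability.Cryptography.blprs_gapSVP_sqrt_dim_to_lwe_classical` (**pqc.S21**), component
Thm. 2.17 = Micciancio–Peikert 2012, Thm. 3.1 (hypothesis `h₂` of
`BLPRSReduction.blprs_gapSVP_sqrt_dim_to_lwe_classical_of_components`):

* `ennreal_*` — bookkeeping between the `ℝ≥0∞` form of the bound and the real terms of the schedule.
* **`eventually_idealLaw_ne_le`** — for `q`, `m` polynomially bounded and BLPRS's hypothesis on `α`,
  for all large `n`: for EVERY kernel `Dk` with average-case advantage `≥ 1/nᶜ` against
  `LWE_{dim n, 2^{lev n}, Ψ̄_{rate₂ α n}}` on `m n` samples, every top solver `F` and every secret `s`, the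
  idealised reduction with raw noise `Ψ̄_{rate₁ α n}`, aggregation `aggK n` and the schedule's
  `reps, trials, meas, extra, gap` outputs `s` except with probability `≤ 7/24 < 1/3`.

What remains for `h₂` after this file is the machine: its per-input computation has the law `idealLaw`
(`LWEPrimePowerDriven.lean` and sequels) and it runs in polynomial time.

## References

* D. Micciancio, C. Peikert, *Trapdoors for lattices: simpler, tighter, faster, smaller*, EUROCRYPT 2012,
  LNCS 7237; full version IACR ePrint 2011/501, §3, Thm. 3.1 and its proof, pp. 15–16 (read:
  `lit read paper:doi-10-1007-978-3-642-29011-4-41`, p0015–p0016). [MicciancioPeikert2012]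
* Z. Brakerski, A. Langlois, C. Peikert, O. Regev, D. Stehlé, *Classical hardness of learning with
  errors*, STOC 2013 (arXiv:1306.0281), Thm. 2.17. [BrakerskiEtAl2013]
-/

noncomputable section

open scoped ENNReal

namespace Literature.Computability.Cryptography

namespace LWE

namespace MP12

open Real Filter BLPRS2013

/-! ### `ℝ≥0∞` bookkeeping -/

section ENN

/-- `↑k · ofReal x = ofReal (k·x)`. [folklore] -/
theorem natCast_mul_ofReal (k : ℕ) (x : ℝ) : (k : ℝ≥0∞) * ENNReal.ofReal x = ENNReal.ofReal (k * x) := by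
  rw [ENNReal.ofReal_mul (Nat.cast_nonneg k), ENNReal.ofReal_natCast]

/-- The digit term in real form. [folklore] -/
theorem ennreal_digit_term {γ b : ℝ} (hγ : γ ≤ 1) (hb : 0 ≤ b) (T : ℕ) :
    (ENNReal.ofReal (1 - γ) + ENNReal.ofReal b) ^ T + (2 - 1 : ℕ) * (T * ENNReal.ofReal b) =
      ENNReal.ofReal ((1 - γ + b) ^ T + T * b) := by
  rw [← ENNReal.ofReal_add (by linarith) hb, ← ENNReal.ofReal_pow (by linarith), natCast_mul_ofReal T,
    show (2 - 1 : ℕ) = 1 from rfl, Nat.cast_one, one_mul, ← ENNReal.ofReal_add (by positivity) (by positivity)]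

/-- The rounding term in real form. [folklore] -/
theorem ennreal_round_term (a b : ℕ) (hb : 0 < b) :
    ((a : ℕ) : ℝ≥0∞) / (b : ℕ) = ENNReal.ofReal ((a : ℝ) / b) := by
  rw [ENNReal.ofReal_div_of_pos (by exact_mod_cast hb), ENNReal.ofReal_natCast, ENNReal.ofReal_natCast]

end ENN

/-! ### The failure bound on the schedule -/

section Failure

variable (c : ℕ) {q m : ℕ → ℕ} {α : ℕ → ℝ}

/-- **The idealised Micciancio–Peikert reduction on BLPRS's schedule fails with probability `≤ 7/24`
for all large `n`**, for every kernel with advantage `≥ 1/nᶜ`, every top solver (restricted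
specification `IsTopSolverFR`) and every secret.
[cite: MicciancioPeikert2012, Thm. 3.1] [cite: BrakerskiEtAl2013, Thm. 2.17] -/
theorem eventually_idealLaw_ne_le (hq : IsPolyBounded q) (hm : IsPolyBounded m)
    (hα : ∀ᶠ n : ℕ in atTop, 0 < α n ∧ α n < 1 ∧ Real.sqrt n * Real.log n ≤ α n * q n) :
    ∀ᶠ n : ℕ in atTop, ∀ (Dk : (Fin (m n) → (Fin (dim n) → ZMod (2 ^ lev n)) × ZMod (2 ^ lev n)) → PMF Bool),
      1 / (n : ℝ) ^ c ≤ distinguishingAdvantage (discretizedGaussian (2 ^ lev n) (rate₂ α n)) (m n) Dk →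
      ∀ (F : ℕ → (Fin (extra n) → (Fin (dim n) → ZMod (2 ^ lev n)) × ZMod (2 ^ lev n)) →
          (Fin (extra n) → ZMod (2 ^ lev n)) → (Fin (dim n) → ZMod (2 ^ lev n))),
        (∀ a, IsTopSolverFR a (lev_pos n) (F a)) →
      ∀ s : Fin (dim n) → ZMod (2 ^ lev n),
        (idealLaw Dk (sumNoise (2 ^ lev n) (discretizedGaussian (2 ^ lev n) (rate₁ α n)) (aggK n))
            (discretizedGaussian (2 ^ lev n) (rate₁ α n)) (reps c n) (trials c n) (meas c n) (extra n) (gap c n) F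
            s).toOuterMeasure {x | x ≠ s} ≤ ENNReal.ofReal (7 / 24) := by
  filter_upwards [eventually_closeness c hα hq hm, eventually_tail c hα hq hm, hα, eventually_ge_atTop 1]
    with n ⟨hδc, hAdv₂, hε0, hε1⟩ ⟨hθ0, hr₀, htail⟩ ⟨hα0, hα1, _⟩ hn1 Dk hDk F hF s
  have hn : (1 : ℝ) ≤ n := by exact_mod_cast hn1
  have hr₁ : 0 < rate₁ α n := by
    have := one_le_dim hn1
    unfold rate₁ rate₂
    positivity
  have hsq := sqrt_aggK_mul_rate₁ α n
  have he := lev_pos n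
  -- the advantage hypothesis in the form of `idealLaw_gaussian_ne_le`
  set ΔK : ℝ := (m n : ℝ) * (((aggK n : ℝ) - 1) / (2 * ((2 ^ lev n : ℕ) : ℝ) * rate₁ α n)) with hΔK
  have hAdv₂' : adv₀ c n + ΔK ≤
      distinguishingAdvantage (discretizedGaussian (2 ^ lev n) (Real.sqrt (aggK n) * rate₁ α n)) (m n) Dk := by
    rw [hsq]
    exact hAdv₂.trans hDk
  have hAdv : adv₀ c n = adv₀ c n + ΔK - ΔK := by ring
  have hθeq : theta c (m n) n = Real.sqrt (Real.log (2 * (1 + 1 / epsC c (m n) n)) / π) := rfl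
  have hmain := idealLaw_gaussian_ne_le (Dk := Dk) (N := reps c n) (T := trials c n) (N' := meas c n)
    (m' := extra n) (γ := gap c n) (F := F) he (reps_pos hn1) (meas_pos hn1) hF hr₁ (one_le_aggK n) hε0 hε1
    hAdv₂' hAdv (adv₀_pos hn1) (gap_eq hn1) hδc (by rw [hsq, ← hθeq]; exact hr₀) s
  refine hmain.trans ?_
  rw [hsq, ← hθeq]
  -- the four terms
  have hγ1 : gap c n ≤ 1 := by
    unfold gap
    rw [div_le_one (by exact_mod_cast invGap_pos hn1)]
    exact_mod_cast invGap_pos (c := c) hn1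
  have hb : 0 ≤ 8 / ((reps c n : ℝ) * gap c n ^ 2) := by positivity
  have h1 : (lev n + 1 : ℕ) * ENNReal.ofReal (1 / (4 * (meas c n : ℝ) * (adv₀ c n / (8 * (lev n : ℝ))) ^ 2)) ≤
      ENNReal.ofReal (1 / 12) := by
    rw [natCast_mul_ofReal _ _]
    exact ENNReal.ofReal_le_ofReal (est_term_le hn1)
  have h2 : (dim n : ℝ≥0∞) * ((lev n : ℝ≥0∞) * ((ENNReal.ofReal (1 - gap c n) +
      ENNReal.ofReal (8 / ((reps c n : ℝ) * gap c n ^ 2))) ^ trials c n +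
        (2 - 1 : ℕ) * ((trials c n : ℝ≥0∞) * ENNReal.ofReal (8 / ((reps c n : ℝ) * gap c n ^ 2))))) ≤
      ENNReal.ofReal (1 / 12) := by
    rw [ennreal_digit_term hγ1 hb, natCast_mul_ofReal _ _, natCast_mul_ofReal _ _]
    refine ENNReal.ofReal_le_ofReal ?_
    have hd := digit_terms_le (c := c) hn1
    have hX : (0 : ℝ) < slack n := by exact_mod_cast slack_pos hn1
    have hslack : (slack n : ℝ) = 24 * dim n * lev n := by unfold slack; push_cast; ring
    have hdpos : (0 : ℝ) < dim n := by exact_mod_cast one_le_dim hn1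
    have hepos : (0 : ℝ) < lev n := by exact_mod_cast he
    calc (dim n : ℝ) * ((lev n : ℝ) * ((1 - gap c n + 8 / ((reps c n : ℝ) * gap c n ^ 2)) ^ trials c n +
          (trials c n : ℝ) * (8 / ((reps c n : ℝ) * gap c n ^ 2))))
        ≤ (dim n : ℝ) * ((lev n : ℝ) * (2 / (slack n : ℝ))) := by gcongr
      _ = 1 / 12 := by rw [hslack]; field_simp; ring
  have h3 : (((2 ^ dim n - 1 : ℕ) : ℝ≥0∞)) / (2 ^ extra n : ℕ) ≤ ENNReal.ofReal (1 / 16) := by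
    rw [ennreal_round_term _ _ (by positivity)]
    exact ENNReal.ofReal_le_ofReal (round_term_le n)
  have h4 : (extra n : ℝ≥0∞) * ENNReal.ofReal (2 * exp (-(Real.pi *
      (rate₂ α n / (2 * theta c (m n) n) - 1 / (2 * ((2 ^ lev n : ℕ) : ℝ))) ^ 2 / rate₁ α n ^ 2))) ≤
      ENNReal.ofReal (1 / 16) := by
    rw [natCast_mul_ofReal _ _]
    exact ENNReal.ofReal_le_ofReal htail
  calc _ ≤ ENNReal.ofReal (1 / 12) + ENNReal.ofReal (1 / 12) + (ENNReal.ofReal (1 / 16) + ENNReal.ofReal (1 / 16)) :=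
        add_le_add (add_le_add h1 h2) (add_le_add h3 h4)
    _ = ENNReal.ofReal (7 / 24) := by
        rw [← ENNReal.ofReal_add (by norm_num) (by norm_num), ← ENNReal.ofReal_add (by norm_num) (by norm_num),
          ← ENNReal.ofReal_add (by norm_num) (by norm_num)]
        norm_num

end Failure

end MP12

end LWE

end Literature.Computability.Cryptography

end
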